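import Summits.BirchSwinnertonDyer.BirchSwinnertonDyer.Theorems.PrintX11aUpperNonSurjThreeSharpLocal
import HarnessLib

/-!
# Route `PrintX11a`, child crux U3 = `PrintX11a.UpperNonSurjThree` (item stmt-BirchSwinnertonDyer-20613),
# line «finemu3» — the local ♯-clause `B_v` in `E[p]`-COEFFICIENTS at every place where `E[p]` has no non-zero point
# fixed by `Gal(K̄_v/K_{v,∞})` (e.g. a NON-SPLIT multiplicative `v = p`, or a bad `v ≠ p` whose Frobenius has no
# eigenvalue `1`): there «`loc_v y ↦ 0` in `H¹(K_{v,∞}, E[p^∞])`» is «`res_{Gal(K̄/K_∞) ⊓ D_v} y = 0` in `H¹(·, E[p])`»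
# (cell `bsd-print-x11a`, width seat `bsd-line-x11a-p1-w2`; REF V14 audit object «explicit B_v at v ∈ S», first case;
# `--supports` 20613; closes nothing)

HONEST FRAMING.  BSD is not proved by any of this; nothing is asserted about any curve; `stub_conjA_three` stays OPEN.
THEOREMS ONLY (no definition, no named fact, no `sorry`), all PROVED (two-line consequences of `…SharpDescent` §1).

WHAT.  REF g17 (V14) lists as the remaining paper steps of the ♯-road the explicit formulae for the local groups
`B_v = ker(H¹(K_v, E[p]) → H¹(K_{v,∞}, E[p^∞]))` at `v ∈ S`.  The coefficient change `E[p] → E[p^∞]` in `B_v` is the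
only non-finite ingredient; it disappears wherever the local cyclotomic tower carries no `p`-torsion of `E`:
if NO non-zero point of `E[p]` is fixed by `Gal(K̄/K_∞) ⊓ D_v` (a condition on the mod-`p` local representation and
`κ` only — e.g. at a non-split multiplicative `v = p` with `p` odd, `E[p]|_{D_p} ≅ (χω ∗; 0 χ)`, `χ` the unramified
quadratic character, or at a multiplicative `v ≠ p` with `p ∣ v_v(Δ)` whose Frobenius `±(1, v)` has no eigenvalue
`1`), then `E[p^∞]` has no such fixed point either and `ι : H¹(Gal(K̄/K_∞) ⊓ D_v, E[p]) → H¹(·, E[p^∞])` is INJECTIVE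
(`…SharpDescent` §1, any subgroup), so the ♯-clause (b) of `…SharpLocal` at `v` reads
«`res_{Gal(K̄/K_∞) ⊓ D_v} y = 0` with `E[p]`-coefficients» — for a class `y` coming from `Hom_G(G_L, E[p])`,
`L = K(E[p])`: «the `p`-extension of `L_𝔴` cut out by `y` lies in `L_𝔴 · K_{v,∞}`», a finite local class-field-theoretic
test.  §1 states this (any number field, any `κ`, any `v`); §2 gives the corresponding variant of the ♯0 door over `ℚ`
in which the places of a displayed set `T` (those satisfying the no-fixed-point test) carry the `E[p]`-clause.

References: [GreenbergLNM1716] §3 Lemmas 3.1, 3.3 (local Kummer kernels `E(F_{∞,η})[p^∞]/p`); [CoatesSujatha2005] §3;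
[DeoRaySujatha2023] §3 (c3) (the no-local-torsion condition at level 0, here relaxed to the tower); REF STATUS
2026-08-28T06:26:48Z (V14).
-/

set_option linter.dupNamespace false
set_option autoImplicit false

noncomputable section

open scoped Classical

open WeierstrassCurve Field NumberField IsDedekindDomain
  Literature.NumberTheory.EllipticCurves
  Literature.NumberTheory.EllipticCurves.GreenbergSelmer
  Literature.NumberTheory.EllipticCurves.Rank1Residual
  Literature.NumberTheory.GaloisRepresentations
  Summit.BirchSwinnertonDyer.Rank1Residual

namespace Summit.BirchSwinnertonDyer.BirchSwinnertonDyer.Theorems.UpperNonSurjThreeSharp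

/-! ### §1 Any number field: the ♯-clause at a tower-torsion-free place is an `E[p]`-statement -/

section AnyField

variable {K : Type} [Field K] [NumberField K] (W : WeierstrassCurve K) {p : ℕ} [Fact p.Prime]
  (κ : ZpExtension K p)

/-- **No tower torsion at `v` ⟹ the local map `H¹(Gal(K̄/K_∞) ⊓ D_v, E[p]) → H¹(·, E[p^∞])` is injective.**
Hypothesis (displayed, decided from the mod-`p` local representation): no non-zero point of `E[p]` is fixed by every
element of `Gal(K̄/K_∞) ⊓ D_v`. [cite: GreenbergLNM1716, §3 Lemma 3.3 (proof: the local Kummer kernel is `E(F_{∞,η})[p^∞]/p`)] -/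
theorem torsionToPrimaryH1Sub_inf_decomp_injective_of_noFixedPoints (v : HeightOneSpectrum (𝓞 K))
    (hloc : ∀ P : geomTorsion W (p : ℤ),
      (∀ σ : (κ.kerSubgroup ⊓ decomp v : Subgroup (absoluteGaloisGroup K)),
        (σ : absoluteGaloisGroup K) • P = P) → P = 0) :
    Function.Injective (W.torsionToPrimaryH1Sub p (κ.kerSubgroup ⊓ decomp v)) :=
  torsionToPrimaryH1Sub_injective_of_fixedPoints_eq_zero W p (κ.kerSubgroup ⊓ decomp v)
    (geomPrimaryTorsion_fixed_eq_zero_of_geomTorsion_fixed_eq_zero W p (κ.kerSubgroup ⊓ decomp v) hloc)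

/-- **The ♯-clause (b) at a tower-torsion-free place, in `E[p]`-coefficients.**  For `y ∈ H¹(K, E[p])` whose
restriction to `K_∞` lands in `Sel₀(K_∞, E[p^∞])` and a finite place `v` with no non-zero `Gal(K̄/K_∞) ⊓ D_v`-fixed point
in `E[p]`: `res_{Gal(K̄/K_∞) ⊓ D_v} y = 0` already in `H¹(·, E[p])` — the `p`-extension cut out by `y` is locally contained in
the cyclotomic tower above `v`.  PROVED (`…SharpLocal` (b) + §1 injectivity).
[cite: GreenbergLNM1716, §3 Lemmas 3.1, 3.3] [cite: DeoRaySujatha2023, §3 (c3)] -/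
theorem resSubgroup_inf_decomp_eq_zero_of_mem_fineSelmerInfty_of_noFixedPoints
    (y : discreteH1 (absoluteGaloisGroup K) (geomTorsion W (p : ℤ)))
    (hy : W.torsionToPrimaryH1Sub p κ.kerSubgroup
      (ResKernel.resSubgroup κ.kerSubgroup (geomTorsion W (p : ℤ)) y) ∈ W.fineSelmerInfty κ)
    (v : HeightOneSpectrum (𝓞 K))
    (hloc : ∀ P : geomTorsion W (p : ℤ),
      (∀ σ : (κ.kerSubgroup ⊓ decomp v : Subgroup (absoluteGaloisGroup K)),
        (σ : absoluteGaloisGroup K) • P = P) → P = 0) :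
    ResKernel.resSubgroup (κ.kerSubgroup ⊓ decomp v) (geomTorsion W (p : ℤ)) y = 0 :=
  torsionToPrimaryH1Sub_inf_decomp_injective_of_noFixedPoints W κ v hloc
    (by rw [map_zero]; exact torsionToPrimaryH1Sub_resSubgroup_inf_decomp_eq_zero_of_mem_fineSelmerInfty W κ y hy v)

end AnyField

/-! ### §2 Over `ℚ`: the ♯0 door with the `E[p]`-clause at the displayed tower-torsion-free places -/

section OverQ

variable (W : WeierstrassCurve ℚ) [W.IsElliptic] (p : ℕ) [Fact p.Prime]

/-- **♯0 with `E[p]`-clauses on a displayed set of places.**  For `E/ℚ` with `E[p]` irreducible and `ρ̄` not onto and a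
set `T` of finite places at each of which (for every cyclotomic `κ`) no non-zero point of `E[p]` is fixed by
`Gal(ℚ̄/ℚ_∞) ⊓ D_v` (displayed hypothesis `hT`): if for every cyclotomic `κ` every `y ∈ H¹(G_ℚ, E[p]; S)` that is
locally ♯-trivial at all finite places (clause (b), `E[p^∞]`-coefficients) AND restricts to `0` on `Gal(ℚ̄/ℚ_∞) ⊓ D_v`
with `E[p]`-coefficients at every `v ∈ T` is `0`, then statement (A) holds at the pair.  (The extra `E[p]`-clauses are
consequences, so the engine may use them; at `v ∈ T` it need not touch `E[p^∞]`.)  PROVED, no named fact; nothing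
asserted about any curve. [cite: CoatesSujatha2005, §3 statement (A)] [cite: GreenbergLNM1716, §3 Lemmas 3.1–3.3] -/
theorem conjAAt_of_irr_of_not_surj_of_forall_local_of_noFixedPoints (hirr : W.HasIrreducibleModPGaloisRep p)
    (hns : ¬ W.HasSurjectiveModNGaloisRep p) (T : Set (HeightOneSpectrum (𝓞 ℚ)))
    (hT : ∀ κ : ZpExtension ℚ p, κ.IsCyclotomic → ∀ v ∈ T, ∀ P : geomTorsion W (p : ℤ),
      (∀ σ : (κ.kerSubgroup ⊓ decomp v : Subgroup (absoluteGaloisGroup ℚ)),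
        (σ : absoluteGaloisGroup ℚ) • P = P) → P = 0)
    (h : ∀ κ : ZpExtension ℚ p, κ.IsCyclotomic →
      ∀ y : discreteH1 (absoluteGaloisGroup ℚ) (geomTorsion W (p : ℤ)),
        y ∈ h1Unramified (geomTorsion W (p : ℤ)) (W.badPlaces (𝓞 ℚ) ∪ {v | ((p : ℤ) : 𝓞 ℚ) ∈ v.asIdeal}) →
        (∀ v : HeightOneSpectrum (𝓞 ℚ),
          W.torsionToPrimaryH1Sub p (κ.kerSubgroup ⊓ decomp v)
            (ResKernel.resSubgroup (κ.kerSubgroup ⊓ decomp v) (geomTorsion W (p : ℤ)) y) = 0) →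
        (∀ v ∈ T, ResKernel.resSubgroup (κ.kerSubgroup ⊓ decomp v) (geomTorsion W (p : ℤ)) y = 0) →
        y = 0) :
    ConjAAt W p :=
  conjAAt_of_irr_of_not_surj_of_forall_local W p hirr hns fun κ hκ y hunr hloc ↦
    h κ hκ y hunr hloc fun v hv ↦
      torsionToPrimaryH1Sub_inf_decomp_injective_of_noFixedPoints W κ v (hT κ hκ v hv)
        (by rw [map_zero]; exact hloc v)

/-- The same door on the route's domain `ClassX11a W p ∧ ¬ Surj W p`. PROVED. [cite: CoatesSujatha2005, §3 statement (A)] -/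
theorem _root_.Summit.BirchSwinnertonDyer.Rank1Residual.ClassX11a.conjAAt_of_not_surj_of_forall_local_of_noFixedPoints
    (W : WeierstrassCurve ℚ) [W.IsElliptic] [W.IsGloballyMinimal] (p : ℕ) [Fact p.Prime]
    (hX : ClassX11a W p) (hns : ¬ Surj W p) (T : Set (HeightOneSpectrum (𝓞 ℚ)))
    (hT : ∀ κ : ZpExtension ℚ p, κ.IsCyclotomic → ∀ v ∈ T, ∀ P : geomTorsion W (p : ℤ),
      (∀ σ : (κ.kerSubgroup ⊓ decomp v : Subgroup (absoluteGaloisGroup ℚ)),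
        (σ : absoluteGaloisGroup ℚ) • P = P) → P = 0)
    (h : ∀ κ : ZpExtension ℚ p, κ.IsCyclotomic →
      ∀ y : discreteH1 (absoluteGaloisGroup ℚ) (geomTorsion W (p : ℤ)),
        y ∈ h1Unramified (geomTorsion W (p : ℤ)) (W.badPlaces (𝓞 ℚ) ∪ {v | ((p : ℤ) : 𝓞 ℚ) ∈ v.asIdeal}) →
        (∀ v : HeightOneSpectrum (𝓞 ℚ),
          W.torsionToPrimaryH1Sub p (κ.kerSubgroup ⊓ decomp v)
            (ResKernel.resSubgroup (κ.kerSubgroup ⊓ decomp v) (geomTorsion W (p : ℤ)) y) = 0) →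
        (∀ v ∈ T, ResKernel.resSubgroup (κ.kerSubgroup ⊓ decomp v) (geomTorsion W (p : ℤ)) y = 0) →
        y = 0) :
    ConjAAt W p :=
  conjAAt_of_irr_of_not_surj_of_forall_local_of_noFixedPoints W p hX.irr hns T hT h

end OverQ

end Summit.BirchSwinnertonDyer.BirchSwinnertonDyer.Theorems.UpperNonSurjThreeSharp

end
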